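import Literature.MathematicalPhysics.QuantumFieldTheory.Balaban1983to89.Node00.N24KnitStage12C

/-!
# NODE N24 · (B2) AT NODE 00's STAGE-12 RECORD IN THE CURRENCY OF CRUX K1′'s REGISTERED SKELETON (route `BalabanUVNodes` rev 15, item stmt-QuantumFields-19903
# `StabilityBAtRecordR12e`; plan g64's `K1Skeleton12.lean` v2 1db6a3ddb04912dc): the thirteen DAG nodes `DagBinding.Nodes (leavesP w P)` at SOME world of the record from N24's
# displayed children (the consequent of `stub_nodes12` GIVEN the children), and the β-cluster step `stub_betaWindow12` REDUCED to the two box bounds on the β of record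
# (window clause PRODUCED, `BetaBoundsInInterval` PACKAGED, lower letter RE-LETTERED — nodes and record untouched)

TRACK A (YM-PLAN §2d, node N24 of 28 = binder B2 `hB : B16.EndStatementBPrinted D.C`), seat `pub-ymgap-dag-n24-c` (R134 fan-out seat, strategy s2 «by-name knit ∕ reduction at
the record»; gen 2).  TWENTY-SIXTH N24 module, a NEW importing one (modules 1–25 untouched; imports module 24 `N24KnitStage12C`).  THEOREMS ONLY, def-free, sorry-free, standard axioms.

WHY.  The crux K1′ `StabilityBAtRecordR12e` (rev 15: guard `(θ.ZtUnity F 2 ∧ θ.SlotsNondegenerate)` bundled on the SAME θ) now carries a REGISTERED two-stub skeleton whose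
currency is NOT N24's `(B2)` sentence but the thirteen-node conjunction at a world of the record:
* `stub_nodes12 : ∀ F, Inhabited12 F → NodesAtSomeRecord12 F` — SOME guarded admissible presentation `(θ, h)` and world `w` with `IsRecordOfRecord₁₂C F 2 (datumOfRecord₁₂ F 2 θ h) w`
  and `∀ P, Nodes (leavesP w P)`;
* `stub_betaWindow12 : ∀ F, NodesAtSomeRecord12 F → BetaWindowAtSomeRecord12 F` — the same PLUS `BetaBoundsInInterval w.C.toB12 w.γ w.b w.βup` PLUS the non-vacuity window
  `∃ γ₁ > 0, ∀ γ ∈ ]0, γ₁], ∃ P, 1 ≤ P.K ∧ ((datumOfRecord₁₂ F 2 θ h).C P).flow.InInterval γ P.K`;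
composed by def-T's `endStatementBPrinted_of_isRecordOfRecord₁₂C_of_nodes` (the (B2) glue IS that theorem).  Modules 23 ∕ 24 conclude `B16.EndStatementBPrinted D.C` directly; this
module states N24's knit IN THE SKELETON'S CURRENCY, so that «which child blocks» is readable stub by stub:
(i) `Nodes (leavesP w P)` reads the world's exponent letters `(em, ep)` (leaf `uvBounds`, [Balaban1988Convergent] Cor. 3 (2.50)), which (B2) does not — N13 WORLD-LEVEL therefore yields
the nodes at the world RE-READ with the Cor.-3 dependence functions `{ w with em := e₋, ep := e₊ }` (again a ₁₂C record over the same datum, §0), N01 ∕ N02 ∕ N04 def-T's transferred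
theorems, N03 module 23's, N05 ∕ N06 ∕ N07 ∕ N08 ∕ N10 ∕ N12 from the θ-keyed sockets (module 23 §0), N11 from the (S1ᵀ) slot (module 24 §0, seat dag-n11-e), N09 the binder `h09`;
(ii) `Nodes (leavesP w P)` does NOT read the world's lower β letter `w.b` (`betaPositive` ∕ `running` ∕ `thm2Regime` are leaves of no DAG node) — so the lower box bound may be asked for
SOME `b > 0` and the world re-lettered to it (§0, `Iff.rfl`); the window conjunct FOLLOWS from the upper box bound alone (module 8 `N24_window_allK_of_betaUpperH`, every finite-ε
datum's flow being forward-generated, length `K := 1`); `BetaBoundsInInterval` is the box pair through the dictionary clause `D.curries` (`DagBinding.betaBoundsInInterval_of_boxBounds`).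
Hence `stub_betaWindow12` = EXACTLY two estimates on the β of record `D.βfun = betaOfRecord₁₀ θ.toStage9Params` (= the merged β over the continuous-version transport on the box,
module 23 §2): the UPPER bound `β ≤ w.βup` on `]0, w.γ]^{k+1}` ([Balaban1987RG1] (1.22) p. 264 «uniformly bounded on this interval», proof deferred in print) and a LOWER bound
`b ≤ β`, `b > 0`, there (printed NOWHERE in the series — cell census T09.F, NODE O).  Nothing else.

WHAT THIS FILE PROVES.
§0 `N24_isRecordOfRecord₁₂C_withExp` ∕ `_withB` (₁₂C reads neither the exponent functions nor the lower β letter of the world); `N24_nodes_withB_iff` (`Iff.rfl`).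
§1 **`N24_nodes₁₂C_knit_N11_pinned`** — `∃ (e₋, e₊), IsRecordOfRecord₁₂C F N D {w with em, ep} ∧ ∀ P, Nodes (leavesP {w with em, ep} P)` from module 24's hypothesis list MINUS the
   β-box (the nodes do not read it): six θ-keyed residual-carrier sockets, N09 ×1 binder, N11 ×1 slot, N13 𝐑-leaf + Cor.-3 leaves.  = WHICH CHILD BLOCKS `stub_nodes12` at a ₁₂C record.
§2 `N24_window_of_betaUpperH` (the crux's window clause at ANY finite-ε datum from an upper box bound), `N24_betaBoundsInInterval_of_isRecordOfRecord₁₂C_of_boxH`,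
   **`N24_betaWindow₁₂C_of_nodes_of_boxH`** — the `stub_betaWindow12` step at a ₁₂C record: nodes kept, world re-lettered to the lower letter `b`, `BetaBoundsInInterval` + window
   from `b ≤ D.βfun ≤ w.βup` on `]0, w.γ]^{k+1}`; `N24_betaWindow₁₂C_of_nodes_of_betaMerged` — the same read at the MERGED β over `mergedTermFamilyMatT (TcOfRecord) (chiFixed7 θ.ν)`.
§3 θ-KEYED SHAPES OF RECORD (rev 15, general `N`, guard `hU : θ.ZtUnity F N ∧ θ.SlotsNondegenerate` DISPLAYED and threaded, never produced):
   `N24_nodesAtRecord₁₂_thetaShape_knit_N11_pinned` (the body of `NodesAtSomeRecord12` witnessed by the presentation at hand GIVEN the children),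
   `N24_betaWindowAtRecord₁₂_thetaShape_of_nodes_of_boxH` (the body of `BetaWindowAtSomeRecord12` from the body of `NodesAtSomeRecord12` at hand + the β-box pair),
   `N24_stabilityBR12e_thetaShape15_knit_N11_pinned` (K1′'s rev-15 CONSEQUENT, module 24 §2's θ-shape with the bundled guard).
§4 THE TWO STUBS' LITERAL TEXTS (unfolded, general `N`; at `N := 2` verbatim `K1Skeleton12` v2): **`N24_betaWindowAtSomeRecord₁₂_of_nodesAtSomeRecord₁₂_of_boxH`** — `stub_betaWindow12`
   GIVEN «at every nodes-bearing guarded Stage-12 record: `D.βfun ≤ w.βup` on the world's box and `∃ b > 0, b ≤ D.βfun` there»; `N24_nodesAtSomeRecord₁₂_of_inhabited₁₂_of_worlds` —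
   `stub_nodes12` GIVEN «every guarded admissible presentation has SOME nodes-bearing world of its datum» (which §3 produces from the children).

WHICH CHILD BLOCKS, per stub (kernel form): `stub_nodes12` ← §1's list (six residual-carrier sockets X-[B8] ∕ X-[B10] ∕ X-B13 ∕ Y ∕ Z ∕ W; N09 ×1 `h09`; N11 ×1 (S1ᵀ); N13 `hR` +
`hcor3`) at a world of a guarded record — inhabitation = K0′ `Record12Inhabited` (stmt-QuantumFields-19902); `stub_betaWindow12` ← β upper ([I] p. 264) + β lower `b > 0` (NODE O,
UNPRINTED) on the β of record along `]0, w.γ]^{k+1}` — the window and the interval packaging are THEOREMS here.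
HONEST FRAMING: kernel bookkeeping BY NAME; nothing of Bałaban's asserted; every slot DISPLAYED; N24 COMPOSITE — no discharge, no count, no stub closed; one finite T⁴ programme
at fixed ε; NOT continuum ∕ ℝ⁴ ∕ OS ∕ mass gap ∕ Clay.
-/

noncomputable section

open scoped Matrix.Norms.L2Operator

namespace Literature.MathematicalPhysics.QuantumFieldTheory.Balaban1983to89.Node00

open DagBinding T4Continuum T4DatumAssembly FlowStepRuns AveragingRT
open FlowStep (BetaLowerH BetaUpperH)

variable {F : T4Family} {N : ℕ} [NeZero N] {D : FiniteEpsData F (SU N)} {w : WorldP}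

/-! ## §0. What ₁₂C and the thirteen nodes do not read: the world's exponent functions and its lower β letter -/

/-- **₁₂C does not read the world's (2.50) exponent functions**: re-reading `(em, ep)` keeps a Stage-12 record over the same datum (the record's clauses bind `C`, `γ`, `L`, `up`
only). [cite: Balaban1988Convergent, Cor. 3 (2.50) p.264; Balaban1989LargeFieldII, Thm 1 p.355 (bookkeeping)] -/
theorem N24_isRecordOfRecord₁₂C_withExp (h : IsRecordOfRecord₁₂C F N D w) (em ep : ℝ → ℝ) :
    IsRecordOfRecord₁₂C F N D { w with em := em, ep := ep } := by
  obtain ⟨θ, hP, hθ, hD, hC, hγ, hL, hup⟩ := h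
  exact ⟨θ, hP, hθ, hD, hC, hγ, hL, hup⟩

/-- **₁₂C does not read the world's lower β letter**: re-lettering `b` to any `b' > 0` keeps a Stage-12 record over the same datum.
[cite: Balaban1987RG1, Thm 2 p.259 (the letter's only printed home); Balaban1989LargeFieldII, Thm 1 p.355 (bookkeeping)] -/
theorem N24_isRecordOfRecord₁₂C_withB (h : IsRecordOfRecord₁₂C F N D w) {b : ℝ} (hb : 0 < b) :
    IsRecordOfRecord₁₂C F N D { w with b := b, b_pos := hb } := by
  obtain ⟨θ, hP, hθ, hD, hC, hγ, hL, hup⟩ := h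
  exact ⟨θ, hP, hθ, hD, hC, hγ, hL, hup⟩

/-- **THE THIRTEEN DAG NODES DO NOT READ THE WORLD'S LOWER β LETTER** (`Iff.rfl`): of the 22 leaves only `betaPositive`, `running` and `thm2Regime` read `w.b`, and no
`Dag.B*_main` names them — the lower β bound enters (B) only through `FlowStepPrinted`, i.e. through the β-binder of the END headline.
[cite: Balaban1989LargeFieldII, Thm 1 p.355; Balaban1988Convergent, (2.6) p.255 (where β enters; bookkeeping)] -/
theorem N24_nodes_withB_iff (w : WorldP) {b : ℝ} (hb : 0 < b) (P : B12.RunParams) :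
    Nodes (leavesP { w with b := b, b_pos := hb } P) ↔ Nodes (leavesP w P) :=
  Iff.rfl

/-! ## §1. The thirteen nodes at a world of the Stage-12 record from N24's displayed children (the `stub_nodes12` consequent GIVEN the children) -/

/-- **N24 · THE THIRTEEN DAG NODES AT A WORLD OF THE STAGE-12 RECORD, FROM THE DISPLAYED CHILDREN** — module 24's hypothesis list WITHOUT the β-box (the nodes do not read it):
N01 ∕ N02 ∕ N04 def-T's transferred theorems (`b4 ∕ b5 ∕ b7_main_of_isRecordOfRecord₁₂C`), N03 module 23's `N24_b6_main_of_isRecordOfRecord₁₂C`, N05 ∕ N06 ∕ N07 ∕ N08 ∕ N10 ∕ N12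
from the θ-keyed residual-carrier sockets over `θ.toStage5₁₂` (module 23 §0), N09 the by-name binder `h09`, N11 from the (S1ᵀ) slot (module 24 §0, seat dag-n11-e's
`B14NodeKnitRecord12R`), N13 WORLD-LEVEL from the record's 𝐑-leaf `hR` and «∃ (e₋, e₊) R, the five [Balaban1988Convergent] Cor.-3 leaves at `(D.C, w.γ)`» (module 15's
`N24_b16_main_withExp_of_cor3Leaves₅C` at the Stage-5 shadow, `D₅.C = D.C` consumed) — AT THE WORLD RE-READ WITH THE Cor.-3 DEPENDENCE FUNCTIONS (`Nodes` reads `(em, ep)`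
through the leaf `uvBounds`; (B2) does not), which is again a ₁₂C record over `D` (§0).  THE HYPOTHESIS LIST IS «WHICH CHILD BLOCKS `stub_nodes12` AT A ₁₂C RECORD» IN KERNEL FORM.
[cite: Balaban1989LargeFieldII, Thm 1 p.355, (0.1) pp.355–356, p.387, p.391; Balaban1988Convergent, Thm 1 p.262, Theorem p.245, p.244, Cor. 3 (2.50) p.264 and pp.283–284; Balaban1987RG1, Thm 1 p.259, Thm 3 p.264; Balaban1985RegularSpaces, Thms 2, 4, 8 pp.83–101; Balaban1985BackgroundPropagators, Thms 3.1–3.15 pp.397–432; Balaban1985Variational, Thm 1 p.279; Balaban1985UV3, Thm 1 p.257 + Thm 2 p.272; Balaban1988RG2Cluster, Lemmas 1–3 pp.9, 11, 20; Balaban1989LargeFieldI, Prop. 1 p.194; Balaban1983RegularityDecay, Theorem p.573; Balaban1984PropagatorsI, Props. 1.1–1.2 pp.33–36; Balaban1984PropagatorsII, pp.234–249; Balaban1985Averaging, Props. 1–10 pp.26–50 (bookkeeping over the Stage-12 record)] -/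
theorem N24_nodes₁₂C_knit_N11_pinned (h : IsRecordOfRecord₁₂C F N D w)
    (slots₀₅ : ∀ (θ : Stage12Params F N) (hP : θ.Provisos₁₂ F N), θ.Admissible F N → D = datumOfRecord₁₂ F N θ hP →
      (∀ P, w.up P = upOfRecord₅C F N (θ.toStage5₁₂ F N) P) → ∀ P : B12.RunParams,
        B8LeafR (θ.res.X P).d8 (θ.res.X P).L8 (θ.res.X P).C₂ (θ.res.X P).B₁' (θ.res.X P).B₀' (θ.res.X P).B₁ (θ.res.X P).B₂ (θ.res.X P).c₁
          (θ.res.X P).inp8 (θ.res.X P).B₀β (θ.res.X P).loc8 (θ.res.X P).fam8R (θ.res.X P).lan8 (θ.res.X P).cub8 (θ.res.X P).toAxial8)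
    (slots₀₆ : ∀ (θ : Stage12Params F N) (hP : θ.Provisos₁₂ F N), θ.Admissible F N → D = datumOfRecord₁₂ F N θ hP →
      (∀ P, w.up P = upOfRecord₅C F N (θ.toStage5₁₂ F N) P) → ∀ P : B12.RunParams, B9LeafX (θ.res.Y P))
    (slots₀₇ : ∀ (θ : Stage12Params F N) (hP : θ.Provisos₁₂ F N), θ.Admissible F N → D = datumOfRecord₁₂ F N θ hP →
      (∀ P, w.up P = upOfRecord₅C F N (θ.toStage5₁₂ F N) P) → ∀ P : B12.RunParams, B11Leaf (θ.res.Z P))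
    (slots₀₈ : ∀ (θ : Stage12Params F N) (hP : θ.Provisos₁₂ F N), θ.Admissible F N → D = datumOfRecord₁₂ F N θ hP →
      (∀ P, w.up P = upOfRecord₅C F N (θ.toStage5₁₂ F N) P) → ∀ P : B12.RunParams,
        ∃ (Xc : PrintedCarriersR) (I : Type) (C : B10Assembly.Consts) (T : I → B10.TowerRun),
          Nonempty (∀ i, B10Assembly.LeafSystem C (T i)) ∧ θ.res.X P = Xc.withTowerRuns10 T)
    (h09 : ∀ P : B12.RunParams, Dag.B12_main (leavesP w P))
    (slots₁₀ : ∀ (θ : Stage12Params F N) (hP : θ.Provisos₁₂ F N), θ.Admissible F N → D = datumOfRecord₁₂ F N θ hP →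
      (∀ P, w.up P = upOfRecord₅C F N (θ.toStage5₁₂ F N) P) → ∀ P : B12.RunParams,
        B9LeafX (θ.res.Y P) →
          (B10.Thm1PrintedCompact (θ.res.X P).runs10 ∧ B10.Thm2Printed (θ.res.X P).runs10) →
            B11Leaf (θ.res.Z P) → B12Sec2to5.Lemma4Printed (θ.res.X P).F12 (θ.res.X P).c12 →
              B13.Lemma1Printed (θ.res.X P).S13 (θ.res.X P).c13 ∧ B13.Lemma2Printed (θ.res.X P).S13 (θ.res.X P).c13 ∧
                B13.Lemma3Printed (θ.res.X P).S13 (θ.res.X P).c13)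
    (slot11 : ∀ (θ : Stage12Params F N) (hP : θ.Provisos₁₂ F N), θ.Admissible F N → D = datumOfRecord₁₂ F N θ hP →
      (∀ P, w.up P = upOfRecord₅C F N (θ.toStage5₁₂ F N) P) → ∀ P : B12.RunParams,
        (leavesP w P).b7 → (leavesP w P).b8 → (leavesP w P).b9 → (leavesP w P).b10 → (leavesP w P).b11 →
          (leavesP w P).smallCouplings → (leavesP w P).smallFieldInductive → (leavesP w P).flowControl →
            ∀ k, k < P.K → SLaw₁₂ F N θ P k → TLaw₁₂ F N θ P k)
    (slots₁₂ : ∀ (θ : Stage12Params F N) (hP : θ.Provisos₁₂ F N), θ.Admissible F N → D = datumOfRecord₁₂ F N θ hP →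
      (∀ P, w.up P = upOfRecord₅C F N (θ.toStage5₁₂ F N) P) → ∀ P : B12.RunParams, B15Leaf (θ.res.W P))
    (hR : ∀ P : B12.RunParams, (w.up P).rOperation)
    (hcor3 : ∃ (em ep : ℝ → ℝ) (R : B14Cor3.ReprFamily D.C),
      B14Cor3.LeafH D.C R w.γ ∧ B14Cor3.LeafU1 D.C R w.γ ∧ B14Cor3.LeafU2 D.C R w.γ ep ∧ B14Cor3.LeafL1 D.C R w.γ ∧ B14Cor3.LeafL2 D.C R w.γ em) :
    ∃ em ep : ℝ → ℝ, IsRecordOfRecord₁₂C F N D { w with em := em, ep := ep } ∧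
      ∀ P : B12.RunParams, Nodes (leavesP { w with em := em, ep := ep } P) := by
  obtain ⟨D₅, h₅, hC5, -⟩ := exists_isRecordOfRecord₅C_of_isRecordOfRecord₁₂C h
  rw [← hC5] at hcor3
  obtain ⟨em, ep, R, hH, hU1, hU2, hL1, hL2⟩ := hcor3
  refine ⟨em, ep, N24_isRecordOfRecord₁₂C_withExp h em ep, fun P => ?_⟩
  exact B16NodeKnitExponents.nodes_withExp_of (b4_main_of_isRecordOfRecord₁₂C h P) (b5_main_of_isRecordOfRecord₁₂C h P)
    (N24_b6_main_of_isRecordOfRecord₁₂C h P) (b7_main_of_isRecordOfRecord₁₂C h P) (N24_b8_main_of_isRecordOfRecord₁₂C_of_slot h slots₀₅ P)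
    (N24_b9_main_of_isRecordOfRecord₁₂C_of_slot h slots₀₆ P) (N24_b10_main_of_isRecordOfRecord₁₂C_of_slot h slots₀₈ P)
    (N24_b11_main_of_isRecordOfRecord₁₂C_of_slot h slots₀₇ P) (h09 P) (N24_b13_main_of_isRecordOfRecord₁₂C_of_slot h slots₁₀ P)
    (N24_b14_main_of_isRecordOfRecord₁₂C_of_slot h slot11 P) (N24_b15_main_of_isRecordOfRecord₁₂C_of_slot h slots₁₂ P)
    (N24_b16_main_withExp_of_cor3Leaves₅C h₅ hR em ep R hH hU1 hU2 hL1 hL2 P)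

/-! ## §2. The β-cluster step (`stub_betaWindow12`) at a Stage-12 record: window PRODUCED, interval PACKAGED, lower letter RE-LETTERED -/

/-- **THE CRUX'S NON-VACUITY WINDOW AT ANY FINITE-ε DATUM FROM AN UPPER BOX BOUND ON ITS β**: `D.βfun ≤ β⁺` on `]0, γ₀]^{k+1}`, `γ₀ > 0` ⇒
`∃ γ₁ > 0, ∀ γ ∈ ]0, γ₁], ∃ P, 1 ≤ P.K ∧ (D.C P).flow.InInterval γ P.K` — `γ₁ := γ₀`, the run `⟨1, 0, g₀⟩` of module 8's `N24_window_allK_of_betaUpperH` (every finite-ε datum's flow is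
forward-generated from its bare coupling, dictionary field `D.fwd`).  The lower β bound is NOT needed for the window. [cite: Balaban1987RG1, (0.17)–(0.20) pp.255–256 and (1.22) p.264 (elementary consequence)] -/
theorem N24_window_of_betaUpperH (D : FiniteEpsData F (SU N)) {βup γ₀ : ℝ} (hγ₀ : 0 < γ₀) (hhi : BetaUpperH βup γ₀ D.βfun) :
    ∃ γ₁ : ℝ, 0 < γ₁ ∧ ∀ γ : ℝ, 0 < γ → γ ≤ γ₁ → ∃ P : B12.RunParams, 1 ≤ P.K ∧ (D.C P).flow.InInterval γ P.K := by
  refine ⟨γ₀, hγ₀, fun γ hγ hγle => ?_⟩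
  obtain ⟨g0, -, hrun⟩ := N24_window_allK_of_betaUpperH D hhi hγ hγle 0 1
  exact ⟨⟨1, 0, g0⟩, le_rfl, hrun⟩

/-- **THE INTERVAL β-BINDER AT A STAGE-12 RECORD FROM BOX BOUNDS ON THE β OF RECORD**: `b ≤ D.βfun ≤ β⁺` on `]0, γ₀]^{k+1}` ⇒ `BetaBoundsInInterval w.C.toB12 γ₀ b β⁺` — the
world's construction IS the datum's (`construction_eq_of_isRecordOfRecord₁₂C`), and the run's printed `β (j+1) x` IS `D.βfun j` at the history `(g_0, …, g_{j-1}, x)` (dictionary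
clause `D.curries`; `DagBinding.betaBoundsInInterval_of_boxBounds`). [cite: Balaban1987RG1, §1 (1.22) p.264; Balaban1989LargeFieldII, Thm 1 p.355 (the binder's consumer; bookkeeping)] -/
theorem N24_betaBoundsInInterval_of_isRecordOfRecord₁₂C_of_boxH (h : IsRecordOfRecord₁₂C F N D w) {γ₀ b βup : ℝ}
    (hlo : BetaLowerH b γ₀ D.βfun) (hhi : BetaUpperH βup γ₀ D.βfun) : BetaBoundsInInterval w.C.toB12 γ₀ b βup := by
  rw [construction_eq_of_isRecordOfRecord₁₂C h]
  exact DagBinding.betaBoundsInInterval_of_boxBounds D.C.toB12 D.βfun D.curries hlo hhi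

/-- **N24 · THE `stub_betaWindow12` STEP AT A STAGE-12 RECORD**: a ₁₂C record `(D, w)` all of whose runs' leaf worlds satisfy the thirteen nodes, an UPPER box bound
`D.βfun ≤ w.βup` on the world's own box `]0, w.γ]^{k+1}` ([Balaban1987RG1] p. 264, proof deferred in print) and a LOWER box bound `b ≤ D.βfun` there for SOME `b > 0` (UNPRINTED — cell
census T09.F, NODE O) give, AT THE WORLD RE-LETTERED TO `b` (again a ₁₂C record over `D` with the same nodes, §0): the interval β-binder `BetaBoundsInInterval w.C.toB12 w.γ b w.βup`
AND the crux's non-vacuity window.  Nothing but the two box bounds is consumed. [cite: Balaban1987RG1, §1 (1.22) p.264, Thm 2 p.259 and (0.17)–(0.20) pp.255–256; Balaban1989LargeFieldII, Thm 1 p.355 (bookkeeping over the Stage-12 record)] -/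
theorem N24_betaWindow₁₂C_of_nodes_of_boxH (h : IsRecordOfRecord₁₂C F N D w) (hn : ∀ P : B12.RunParams, Nodes (leavesP w P)) {b : ℝ} (hb : 0 < b)
    (hlo : BetaLowerH b w.γ D.βfun) (hhi : BetaUpperH w.βup w.γ D.βfun) :
    IsRecordOfRecord₁₂C F N D { w with b := b, b_pos := hb } ∧ (∀ P : B12.RunParams, Nodes (leavesP { w with b := b, b_pos := hb } P)) ∧
      BetaBoundsInInterval w.C.toB12 w.γ b w.βup ∧
      ∃ γ₁ : ℝ, 0 < γ₁ ∧ ∀ γ : ℝ, 0 < γ → γ ≤ γ₁ → ∃ P : B12.RunParams, 1 ≤ P.K ∧ (D.C P).flow.InInterval γ P.K :=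
  ⟨N24_isRecordOfRecord₁₂C_withB h hb, fun P => (N24_nodes_withB_iff w hb P).2 (hn P), N24_betaBoundsInInterval_of_isRecordOfRecord₁₂C_of_boxH h hlo hhi,
    N24_window_of_betaUpperH D (gamma_pos_of_isRecordOfRecord₁₂C h) hhi⟩

/-- **The same step with the box bounds READ AT THE MERGED β OVER THE CONTINUOUS-VERSION TRANSPORT** for every presentation `(θ, hP)` of the record binding the world's box
(`w.γ ≤ θ.γ`): `∃ b > 0, b ≤ β_merged` and `β_merged ≤ w.βup` on `]0, w.γ]^{k+1}`, `β_merged = betaMerged F (mergedTermFamilyMatT F N (TcOfRecord F N) (chiFixed7 F N θ.ν) θ.εbg) θ.ρ8 θ.bV`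
— the record's own version-free objects (module 23 §2's `N24_betaLowerH_iff_merged₁₂` ∕ `N24_betaUpperH_iff_merged₁₂`).  Conclusion in the `∃ b` form.
[cite: Balaban1987RG1, (0.19) p.255, (1.20)–(1.22) p.264, (2.12)–(2.14) p.268, Thm 2 p.259; Balaban1989LargeFieldII, Thm 1 p.355 (bookkeeping over the Stage-12 record)] -/
theorem N24_betaWindow₁₂C_of_nodes_of_betaMerged (h : IsRecordOfRecord₁₂C F N D w) (hn : ∀ P : B12.RunParams, Nodes (leavesP w P))
    (hβm : ∀ (θ : Stage12Params F N) (hP : θ.Provisos₁₂ F N), θ.Admissible F N → D = datumOfRecord₁₂ F N θ hP → w.γ ≤ θ.γ →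
      letI := θ.instVβ₁; letI := θ.instVβ₂; letI := θ.instιβ
      (∃ b : ℝ, 0 < b ∧ BetaLowerH b w.γ (betaMerged F (mergedTermFamilyMatT F N (TcOfRecord F N) (chiFixed7 F N θ.ν) θ.εbg) θ.ρ8 θ.bV)) ∧
        BetaUpperH w.βup w.γ (betaMerged F (mergedTermFamilyMatT F N (TcOfRecord F N) (chiFixed7 F N θ.ν) θ.εbg) θ.ρ8 θ.bV)) :
    ∃ (b : ℝ) (hb : 0 < b), IsRecordOfRecord₁₂C F N D { w with b := b, b_pos := hb } ∧ (∀ P : B12.RunParams, Nodes (leavesP { w with b := b, b_pos := hb } P)) ∧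
      BetaBoundsInInterval w.C.toB12 w.γ b w.βup ∧
      ∃ γ₁ : ℝ, 0 < γ₁ ∧ ∀ γ : ℝ, 0 < γ → γ ≤ γ₁ → ∃ P : B12.RunParams, 1 ≤ P.K ∧ (D.C P).flow.InInterval γ P.K := by
  obtain ⟨θ, hP, hθ, hD, -, hγ, -, -⟩ := id h
  obtain ⟨⟨b, hb, hlo⟩, hhi⟩ := hβm θ hP hθ hD hγ.2
  exact ⟨b, hb, N24_betaWindow₁₂C_of_nodes_of_boxH h hn hb ((N24_betaLowerH_iff_merged₁₂ θ hP hD hγ.2).mpr hlo)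
    ((N24_betaUpperH_iff_merged₁₂ θ hP hD hγ.2).mpr hhi)⟩

/-! ## §3. θ-keyed shapes of record (rev 15 of the route: the guard `θ.ZtUnity F N ∧ θ.SlotsNondegenerate` bundled on the same θ — DISPLAYED, threaded, never produced) -/

/-- **THE BODY OF `NodesAtSomeRecord12` WITNESSED BY THE PRESENTATION AT HAND, GIVEN THE CHILDREN** (general `N`; at `N := 2` the skeleton's text): a guarded admissible
presentation `(θ, hP)` (`hU : θ.ZtUnity F N ∧ θ.SlotsNondegenerate` — DISPLAYED, a hypothesis of the crux's own antecedent K0′ `Record12Inhabited`, not discharged here), a world `w`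
of its datum of record and §1's children at `(datumOfRecord₁₂ F N θ hP, w)` give `∃ θ' h' w', (θ'.ZtUnity ∧ θ'.SlotsNondegenerate) ∧ θ'.Admissible ∧ IsRecordOfRecord₁₂C F N (datumOfRecord₁₂
F N θ' h') w' ∧ ∀ P, Nodes (leavesP w' P)` — witnesses `θ' := θ`, `w' := { w with em, ep }` (§1).  COMPOSITE: the stub's consequent GIVEN the children; nothing is discharged.
[cite: Balaban1989LargeFieldII, Thm 1 p.355 + p.391; Balaban1988Convergent, (3.16)–(3.22) pp.268–269 (partition of unity ∕ present slots; bookkeeping)] -/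
theorem N24_nodesAtRecord₁₂_thetaShape_knit_N11_pinned (h : IsRecordOfRecord₁₂C F N D w)
    (θ : Stage12Params F N) (hP : θ.Provisos₁₂ F N) (hθ : θ.Admissible F N) (hU : θ.ZtUnity F N ∧ θ.SlotsNondegenerate)
    (hD : D = datumOfRecord₁₂ F N θ hP)
    (slots₀₅ : ∀ (θ : Stage12Params F N) (hP : θ.Provisos₁₂ F N), θ.Admissible F N → D = datumOfRecord₁₂ F N θ hP →
      (∀ P, w.up P = upOfRecord₅C F N (θ.toStage5₁₂ F N) P) → ∀ P : B12.RunParams,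
        B8LeafR (θ.res.X P).d8 (θ.res.X P).L8 (θ.res.X P).C₂ (θ.res.X P).B₁' (θ.res.X P).B₀' (θ.res.X P).B₁ (θ.res.X P).B₂ (θ.res.X P).c₁
          (θ.res.X P).inp8 (θ.res.X P).B₀β (θ.res.X P).loc8 (θ.res.X P).fam8R (θ.res.X P).lan8 (θ.res.X P).cub8 (θ.res.X P).toAxial8)
    (slots₀₆ : ∀ (θ : Stage12Params F N) (hP : θ.Provisos₁₂ F N), θ.Admissible F N → D = datumOfRecord₁₂ F N θ hP →
      (∀ P, w.up P = upOfRecord₅C F N (θ.toStage5₁₂ F N) P) → ∀ P : B12.RunParams, B9LeafX (θ.res.Y P))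
    (slots₀₇ : ∀ (θ : Stage12Params F N) (hP : θ.Provisos₁₂ F N), θ.Admissible F N → D = datumOfRecord₁₂ F N θ hP →
      (∀ P, w.up P = upOfRecord₅C F N (θ.toStage5₁₂ F N) P) → ∀ P : B12.RunParams, B11Leaf (θ.res.Z P))
    (slots₀₈ : ∀ (θ : Stage12Params F N) (hP : θ.Provisos₁₂ F N), θ.Admissible F N → D = datumOfRecord₁₂ F N θ hP →
      (∀ P, w.up P = upOfRecord₅C F N (θ.toStage5₁₂ F N) P) → ∀ P : B12.RunParams,
        ∃ (Xc : PrintedCarriersR) (I : Type) (C : B10Assembly.Consts) (T : I → B10.TowerRun),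
          Nonempty (∀ i, B10Assembly.LeafSystem C (T i)) ∧ θ.res.X P = Xc.withTowerRuns10 T)
    (h09 : ∀ P : B12.RunParams, Dag.B12_main (leavesP w P))
    (slots₁₀ : ∀ (θ : Stage12Params F N) (hP : θ.Provisos₁₂ F N), θ.Admissible F N → D = datumOfRecord₁₂ F N θ hP →
      (∀ P, w.up P = upOfRecord₅C F N (θ.toStage5₁₂ F N) P) → ∀ P : B12.RunParams,
        B9LeafX (θ.res.Y P) →
          (B10.Thm1PrintedCompact (θ.res.X P).runs10 ∧ B10.Thm2Printed (θ.res.X P).runs10) →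
            B11Leaf (θ.res.Z P) → B12Sec2to5.Lemma4Printed (θ.res.X P).F12 (θ.res.X P).c12 →
              B13.Lemma1Printed (θ.res.X P).S13 (θ.res.X P).c13 ∧ B13.Lemma2Printed (θ.res.X P).S13 (θ.res.X P).c13 ∧
                B13.Lemma3Printed (θ.res.X P).S13 (θ.res.X P).c13)
    (slot11 : ∀ (θ : Stage12Params F N) (hP : θ.Provisos₁₂ F N), θ.Admissible F N → D = datumOfRecord₁₂ F N θ hP →
      (∀ P, w.up P = upOfRecord₅C F N (θ.toStage5₁₂ F N) P) → ∀ P : B12.RunParams,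
        (leavesP w P).b7 → (leavesP w P).b8 → (leavesP w P).b9 → (leavesP w P).b10 → (leavesP w P).b11 →
          (leavesP w P).smallCouplings → (leavesP w P).smallFieldInductive → (leavesP w P).flowControl →
            ∀ k, k < P.K → SLaw₁₂ F N θ P k → TLaw₁₂ F N θ P k)
    (slots₁₂ : ∀ (θ : Stage12Params F N) (hP : θ.Provisos₁₂ F N), θ.Admissible F N → D = datumOfRecord₁₂ F N θ hP →
      (∀ P, w.up P = upOfRecord₅C F N (θ.toStage5₁₂ F N) P) → ∀ P : B12.RunParams, B15Leaf (θ.res.W P))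
    (hR : ∀ P : B12.RunParams, (w.up P).rOperation)
    (hcor3 : ∃ (em ep : ℝ → ℝ) (R : B14Cor3.ReprFamily D.C),
      B14Cor3.LeafH D.C R w.γ ∧ B14Cor3.LeafU1 D.C R w.γ ∧ B14Cor3.LeafU2 D.C R w.γ ep ∧ B14Cor3.LeafL1 D.C R w.γ ∧ B14Cor3.LeafL2 D.C R w.γ em) :
    ∃ (θ' : Stage12Params F N) (h' : θ'.Provisos₁₂ F N) (w' : WorldP), (θ'.ZtUnity F N ∧ θ'.SlotsNondegenerate) ∧ θ'.Admissible F N ∧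
      IsRecordOfRecord₁₂C F N (datumOfRecord₁₂ F N θ' h') w' ∧ ∀ P : B12.RunParams, Nodes (leavesP w' P) := by
  obtain ⟨em, ep, hrec, hn⟩ := N24_nodes₁₂C_knit_N11_pinned h slots₀₅ slots₀₆ slots₀₇ slots₀₈ h09 slots₁₀ slot11 slots₁₂ hR hcor3
  subst hD
  exact ⟨θ, hP, { w with em := em, ep := ep }, hU, hθ, hrec, hn⟩

/-- **THE BODY OF `BetaWindowAtSomeRecord12` FROM THE BODY OF `NodesAtSomeRecord12` AT HAND AND THE β-BOX PAIR** (general `N`; at `N := 2` the skeleton's texts): a guarded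
admissible presentation `(θ, hP)`, a world `w` of its datum with all thirteen nodes, `D.βfun ≤ w.βup` on `]0, w.γ]^{k+1}` ([Balaban1987RG1] p. 264) and `b ≤ D.βfun` there for some
`b > 0` (UNPRINTED, NODE O) give `∃ θ' h' w', (guard) ∧ Admissible ∧ IsRecordOfRecord₁₂C … w' ∧ (∀ P, Nodes (leavesP w' P)) ∧ BetaBoundsInInterval w'.C.toB12 w'.γ w'.b w'.βup ∧ window` —
witnesses `θ' := θ`, `w' := { w with b }` (§2).  This is `stub_betaWindow12` AT ONE RECORD, reduced to the two box bounds.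
[cite: Balaban1987RG1, §1 (1.22) p.264, Thm 2 p.259, (0.17)–(0.20) pp.255–256; Balaban1989LargeFieldII, Thm 1 p.355 (bookkeeping over the Stage-12 record)] -/
theorem N24_betaWindowAtRecord₁₂_thetaShape_of_nodes_of_boxH (θ : Stage12Params F N) (hP : θ.Provisos₁₂ F N) (hU : θ.ZtUnity F N ∧ θ.SlotsNondegenerate)
    (hθ : θ.Admissible F N) (h : IsRecordOfRecord₁₂C F N (datumOfRecord₁₂ F N θ hP) w) (hn : ∀ P : B12.RunParams, Nodes (leavesP w P))
    {b : ℝ} (hb : 0 < b) (hlo : BetaLowerH b w.γ (datumOfRecord₁₂ F N θ hP).βfun) (hhi : BetaUpperH w.βup w.γ (datumOfRecord₁₂ F N θ hP).βfun) :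
    ∃ (θ' : Stage12Params F N) (h' : θ'.Provisos₁₂ F N) (w' : WorldP), (θ'.ZtUnity F N ∧ θ'.SlotsNondegenerate) ∧ θ'.Admissible F N ∧
      IsRecordOfRecord₁₂C F N (datumOfRecord₁₂ F N θ' h') w' ∧ (∀ P : B12.RunParams, Nodes (leavesP w' P)) ∧
      BetaBoundsInInterval w'.C.toB12 w'.γ w'.b w'.βup ∧
      ∃ γ₁ : ℝ, 0 < γ₁ ∧ ∀ γ : ℝ, 0 < γ → γ ≤ γ₁ → ∃ P : B12.RunParams, 1 ≤ P.K ∧ ((datumOfRecord₁₂ F N θ' h').C P).flow.InInterval γ P.K := by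
  obtain ⟨hrec, hn', hβ, hW⟩ := N24_betaWindow₁₂C_of_nodes_of_boxH h hn hb hlo hhi
  exact ⟨θ, hP, { w with b := b, b_pos := hb }, hU, hθ, hrec, hn', hβ, hW⟩

/-- **THE CONSEQUENT OF ITEM K1′ `StabilityBAtRecordR12e` IN ITS θ-KEYED SHAPE OF RECORD, REV 15** (`route-QuantumFields-BalabanUVNodes` rev 15, item stmt-QuantumFields-19903:
`∃ (θ : Stage12Params F 2) (h : θ.Provisos₁₂ F 2), (θ.ZtUnity F 2 ∧ θ.SlotsNondegenerate) ∧ θ.Admissible F 2 ∧ B16.EndStatementBPrinted (datumOfRecord₁₂ F 2 θ h).C ∧ ∃ γ₁ > 0, ∀ γ ∈ ]0, γ₁],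
∃ P, 1 ≤ P.K ∧ ((datumOfRecord₁₂ F 2 θ h).C P).flow.InInterval γ P.K`), at general `N` — module 24's `N24_stabilityBR12e_thetaShape_knit_N11_pinned` with the rev-15 BUNDLED guard
`hU : θ.ZtUnity F N ∧ θ.SlotsNondegenerate` DISPLAYED (a hypothesis of the item's own antecedent K0′, not discharged here; destructured nowhere).  COMPOSITE: the item's body GIVEN the
children; nothing is discharged. [cite: Balaban1989LargeFieldII, Thm 1 p.355 + p.391; Balaban1988Convergent, (3.16)–(3.22) pp.268–269; Balaban1987RG1, (0.17)–(0.20) pp.255–256 (bookkeeping + elementary window)] -/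
theorem N24_stabilityBR12e_thetaShape15_knit_N11_pinned (h : IsRecordOfRecord₁₂C F N D w) {γ₀ : ℝ} (hγ₀ : w.γ ≤ γ₀)
    (θ : Stage12Params F N) (hP : θ.Provisos₁₂ F N) (hθ : θ.Admissible F N) (hU : θ.ZtUnity F N ∧ θ.SlotsNondegenerate)
    (hD : D = datumOfRecord₁₂ F N θ hP)
    (slots₀₅ : ∀ (θ : Stage12Params F N) (hP : θ.Provisos₁₂ F N), θ.Admissible F N → D = datumOfRecord₁₂ F N θ hP →
      (∀ P, w.up P = upOfRecord₅C F N (θ.toStage5₁₂ F N) P) → ∀ P : B12.RunParams,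
        B8LeafR (θ.res.X P).d8 (θ.res.X P).L8 (θ.res.X P).C₂ (θ.res.X P).B₁' (θ.res.X P).B₀' (θ.res.X P).B₁ (θ.res.X P).B₂ (θ.res.X P).c₁
          (θ.res.X P).inp8 (θ.res.X P).B₀β (θ.res.X P).loc8 (θ.res.X P).fam8R (θ.res.X P).lan8 (θ.res.X P).cub8 (θ.res.X P).toAxial8)
    (slots₀₆ : ∀ (θ : Stage12Params F N) (hP : θ.Provisos₁₂ F N), θ.Admissible F N → D = datumOfRecord₁₂ F N θ hP →
      (∀ P, w.up P = upOfRecord₅C F N (θ.toStage5₁₂ F N) P) → ∀ P : B12.RunParams, B9LeafX (θ.res.Y P))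
    (slots₀₇ : ∀ (θ : Stage12Params F N) (hP : θ.Provisos₁₂ F N), θ.Admissible F N → D = datumOfRecord₁₂ F N θ hP →
      (∀ P, w.up P = upOfRecord₅C F N (θ.toStage5₁₂ F N) P) → ∀ P : B12.RunParams, B11Leaf (θ.res.Z P))
    (slots₀₈ : ∀ (θ : Stage12Params F N) (hP : θ.Provisos₁₂ F N), θ.Admissible F N → D = datumOfRecord₁₂ F N θ hP →
      (∀ P, w.up P = upOfRecord₅C F N (θ.toStage5₁₂ F N) P) → ∀ P : B12.RunParams,
        ∃ (Xc : PrintedCarriersR) (I : Type) (C : B10Assembly.Consts) (T : I → B10.TowerRun),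
          Nonempty (∀ i, B10Assembly.LeafSystem C (T i)) ∧ θ.res.X P = Xc.withTowerRuns10 T)
    (h09 : ∀ P : B12.RunParams, Dag.B12_main (leavesP w P))
    (slots₁₀ : ∀ (θ : Stage12Params F N) (hP : θ.Provisos₁₂ F N), θ.Admissible F N → D = datumOfRecord₁₂ F N θ hP →
      (∀ P, w.up P = upOfRecord₅C F N (θ.toStage5₁₂ F N) P) → ∀ P : B12.RunParams,
        B9LeafX (θ.res.Y P) →
          (B10.Thm1PrintedCompact (θ.res.X P).runs10 ∧ B10.Thm2Printed (θ.res.X P).runs10) →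
            B11Leaf (θ.res.Z P) → B12Sec2to5.Lemma4Printed (θ.res.X P).F12 (θ.res.X P).c12 →
              B13.Lemma1Printed (θ.res.X P).S13 (θ.res.X P).c13 ∧ B13.Lemma2Printed (θ.res.X P).S13 (θ.res.X P).c13 ∧
                B13.Lemma3Printed (θ.res.X P).S13 (θ.res.X P).c13)
    (slot11 : ∀ (θ : Stage12Params F N) (hP : θ.Provisos₁₂ F N), θ.Admissible F N → D = datumOfRecord₁₂ F N θ hP →
      (∀ P, w.up P = upOfRecord₅C F N (θ.toStage5₁₂ F N) P) → ∀ P : B12.RunParams,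
        (leavesP w P).b7 → (leavesP w P).b8 → (leavesP w P).b9 → (leavesP w P).b10 → (leavesP w P).b11 →
          (leavesP w P).smallCouplings → (leavesP w P).smallFieldInductive → (leavesP w P).flowControl →
            ∀ k, k < P.K → SLaw₁₂ F N θ P k → TLaw₁₂ F N θ P k)
    (slots₁₂ : ∀ (θ : Stage12Params F N) (hP : θ.Provisos₁₂ F N), θ.Admissible F N → D = datumOfRecord₁₂ F N θ hP →
      (∀ P, w.up P = upOfRecord₅C F N (θ.toStage5₁₂ F N) P) → ∀ P : B12.RunParams, B15Leaf (θ.res.W P))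
    (hR : ∀ P : B12.RunParams, (w.up P).rOperation)
    (hcor3 : ∃ (em ep : ℝ → ℝ) (R : B14Cor3.ReprFamily D.C),
      B14Cor3.LeafH D.C R w.γ ∧ B14Cor3.LeafU1 D.C R w.γ ∧ B14Cor3.LeafU2 D.C R w.γ ep ∧ B14Cor3.LeafL1 D.C R w.γ ∧ B14Cor3.LeafL2 D.C R w.γ em)
    (hlo : BetaLowerH w.b γ₀ D.βfun) (hhi : BetaUpperH w.βup γ₀ D.βfun) :
    ∃ (θ' : Stage12Params F N) (h' : θ'.Provisos₁₂ F N), (θ'.ZtUnity F N ∧ θ'.SlotsNondegenerate) ∧ θ'.Admissible F N ∧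
      B16.EndStatementBPrinted (datumOfRecord₁₂ F N θ' h').C ∧
      ∃ γ₁ : ℝ, 0 < γ₁ ∧ ∀ γ : ℝ, 0 < γ → γ ≤ γ₁ → ∃ P : B12.RunParams, 1 ≤ P.K ∧ ((datumOfRecord₁₂ F N θ' h').C P).flow.InInterval γ P.K := by
  obtain ⟨-, hB, hW⟩ := N24_stabilityBR12e_shape₁₂C_knit_N11_pinned h hγ₀ le_rfl 0 slots₀₅ slots₀₆ slots₀₇ slots₀₈ h09 slots₁₀ slot11 slots₁₂ hR hcor3 hlo hhi
  subst hD
  exact ⟨θ, hP, hU, hθ, hB, hW⟩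

end Literature.MathematicalPhysics.QuantumFieldTheory.Balaban1983to89.Node00

/-! ## §4. The two registered stubs' LITERAL TEXTS, reduced (general `N`; at `N := 2` verbatim the v2 skeleton's `NodesAtSomeRecord12` ∕ `BetaWindowAtSomeRecord12` ∕ `Window` ∕ `Inhabited12`) -/

namespace Literature.MathematicalPhysics.QuantumFieldTheory.Balaban1983to89.Node00

open DagBinding T4Continuum T4DatumAssembly
open FlowStep (BetaLowerH BetaUpperH)

variable {N : ℕ} [NeZero N]

/-- **`stub_betaWindow12` GIVEN THE β-BOX PAIR AT EVERY NODES-BEARING GUARDED STAGE-12 RECORD** (the stub's hypothesis and conclusion UNFOLDED, general `N`; at `N := 2` they are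
`NodesAtSomeRecord12 F` and `BetaWindowAtSomeRecord12 F` of plan g64's `K1Skeleton12.lean` v2 verbatim): if at every guarded admissible presentation `(θ, hP)` and every world `w` of its
datum carrying the thirteen nodes the β of record satisfies `D.βfun ≤ w.βup` on `]0, w.γ]^{k+1}` ([Balaban1987RG1] (1.22) p. 264, «uniformly bounded on this interval») and `b ≤ D.βfun`
there for SOME `b > 0` (UNPRINTED — T09.F, NODE O), then `NodesAtSomeRecord12 F → BetaWindowAtSomeRecord12 F`.  THE β-BOX PAIR IS ALL THAT `stub_betaWindow12` NEEDS: the window and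
the interval packaging are §2's theorems.  Nothing of the pair is asserted. [cite: Balaban1987RG1, §1 (1.22) p.264, Thm 2 p.259, (0.17)–(0.20) pp.255–256; Balaban1989LargeFieldII, Thm 1 p.355 (bookkeeping)] -/
theorem N24_betaWindowAtSomeRecord₁₂_of_nodesAtSomeRecord₁₂_of_boxH
    (hβ : ∀ (F : T4Family) (θ : Stage12Params F N) (hP : θ.Provisos₁₂ F N) (w : WorldP), θ.ZtUnity F N ∧ θ.SlotsNondegenerate → θ.Admissible F N →
      IsRecordOfRecord₁₂C F N (datumOfRecord₁₂ F N θ hP) w → (∀ P : B12.RunParams, Nodes (leavesP w P)) →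
        BetaUpperH w.βup w.γ (datumOfRecord₁₂ F N θ hP).βfun ∧ ∃ b : ℝ, 0 < b ∧ BetaLowerH b w.γ (datumOfRecord₁₂ F N θ hP).βfun)
    (F : T4Family)
    (h₁ : ∃ (θ : Stage12Params F N) (h : θ.Provisos₁₂ F N) (w : WorldP), (θ.ZtUnity F N ∧ θ.SlotsNondegenerate) ∧ θ.Admissible F N ∧
      IsRecordOfRecord₁₂C F N (datumOfRecord₁₂ F N θ h) w ∧ ∀ P : B12.RunParams, Nodes (leavesP w P)) :
    ∃ (θ : Stage12Params F N) (h : θ.Provisos₁₂ F N) (w : WorldP), (θ.ZtUnity F N ∧ θ.SlotsNondegenerate) ∧ θ.Admissible F N ∧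
      IsRecordOfRecord₁₂C F N (datumOfRecord₁₂ F N θ h) w ∧ (∀ P : B12.RunParams, Nodes (leavesP w P)) ∧
      BetaBoundsInInterval w.C.toB12 w.γ w.b w.βup ∧
      ∃ γ₁ : ℝ, 0 < γ₁ ∧ ∀ γ : ℝ, 0 < γ → γ ≤ γ₁ → ∃ P : B12.RunParams, 1 ≤ P.K ∧ ((datumOfRecord₁₂ F N θ h).C P).flow.InInterval γ P.K := by
  obtain ⟨θ, hP, w, hU, hθ, h, hn⟩ := h₁
  obtain ⟨hhi, b, hb, hlo⟩ := hβ F θ hP w hU hθ h hn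
  exact N24_betaWindowAtRecord₁₂_thetaShape_of_nodes_of_boxH θ hP hU hθ h hn hb hlo hhi

/-- **`stub_nodes12` GIVEN, FOR EVERY GUARDED ADMISSIBLE PRESENTATION, SOME NODES-BEARING WORLD OF ITS DATUM** (texts UNFOLDED, general `N`; at `N := 2` they are `Inhabited12 F`
and `NodesAtSomeRecord12 F` verbatim): the V1 ∃-currency reading — the prover CHOOSES the record's world (print's «there exist constants»), and §3's
`N24_nodesAtRecord₁₂_thetaShape_knit_N11_pinned` produces such a world from N24's displayed children at any world of the datum (def-T's `exists_world_isRecordOfRecord₁₂C` gives worlds;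
their children's leaves are exactly the displayed slots).  Nothing of the supplier is asserted. [cite: Balaban1989LargeFieldII, Thm 1 p.355 + p.391 (bookkeeping)] -/
theorem N24_nodesAtSomeRecord₁₂_of_inhabited₁₂_of_worlds
    (hsup : ∀ (F : T4Family) (θ : Stage12Params F N) (hP : θ.Provisos₁₂ F N), θ.ZtUnity F N ∧ θ.SlotsNondegenerate → θ.Admissible F N →
      ∃ w : WorldP, IsRecordOfRecord₁₂C F N (datumOfRecord₁₂ F N θ hP) w ∧ ∀ P : B12.RunParams, Nodes (leavesP w P))
    (F : T4Family) (h₀ : ∃ θ : Stage12Params F N, θ.Provisos₁₂ F N ∧ (θ.ZtUnity F N ∧ θ.SlotsNondegenerate) ∧ θ.Admissible F N) :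
    ∃ (θ : Stage12Params F N) (h : θ.Provisos₁₂ F N) (w : WorldP), (θ.ZtUnity F N ∧ θ.SlotsNondegenerate) ∧ θ.Admissible F N ∧
      IsRecordOfRecord₁₂C F N (datumOfRecord₁₂ F N θ h) w ∧ ∀ P : B12.RunParams, Nodes (leavesP w P) := by
  obtain ⟨θ, hP, hU, hθ⟩ := h₀
  obtain ⟨w, h, hn⟩ := hsup F θ hP hU hθ
  exact ⟨θ, hP, w, hU, hθ, h, hn⟩

end Literature.MathematicalPhysics.QuantumFieldTheory.Balaban1983to89.Node00

end
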